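/-
Copyright (c) 2026. All rights reserved.
Released under Apache 2.0 license as described in the file LICENSE.
-/
import Mathlib
import HarnessLib
import Summits.RiemannHypothesis.RiemannHypothesis.Theorems.EarlyAppointmentsEpsRegularCountBound

/-!
# G bound from ε-regular zeros: the complete chain

Uses finite_of_ncard_bound to construct Finset, then applies comb_sum_im_bound_strong
and G_im_bound_from_count_strong.
-/

open Complex Real Set Filter Topology Metric
open scoped BigOperators Topology ComplexConjugate

noncomputable section

namespace GBoundComplete

/-- The center point. -/
abbrev c (x₀ h : ℝ) : ℂ := (x₀ : ℂ) + h * Complex.I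

/-- G.im bound from ε-regular zeros using the effective ε' approach.
With ε' = ε + s/h, the count bound (1-ε')·2h/s ≤ total_count holds.
Then comb_im ≤ -(1-ε')/s ≤ -(5/8)/s, giving -G.im > 4/h. -/
theorem G_im_bound_from_eps_regular {x₀ s h ε η : ℝ}
    (hs : 0 < s) (hh : 0 < h)
    (_hη : 0 ≤ η) (hη_small : η ≤ 1 / 8)
    (_hε : 0 ≤ ε) (hε_small : ε ≤ 1 / 8)
    (hsh : 8 * s ≤ h)
    (S : Finset ℝ) (hS_in : ∀ ξ ∈ S, |x₀ - ξ| ≤ h)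
    (hS_count : ((1 - (ε + s / h)) * 2 * h / s : ℝ) ≤ S.card) :
    let comb := ∑ ξ ∈ S, ((c x₀ h - (ξ : ℂ))⁻¹).im
    let _ε' := ε + s / h
    let G_im := -1 / (2 * h) + comb + η / s
    (-G_im) > 4 / h := by
  intro comb ε' G_im
  -- Step 1: ε' ≤ 1/4 (from eps_regular_effective_count lemmas)
  have hε'_bound : ε' ≤ 1 / 4 := by
    have h1 : s / h ≤ 1 / 8 := by
      rw [div_le_div_iff₀ hh (by norm_num : (0 : ℝ) < 8)]
      linarith
    simp only [ε']
    linarith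
  -- Step 2: 1 - ε' - η ≥ 5/8
  have h_coeff : 1 - ε' - η ≥ 5 / 8 := by linarith
  -- Step 3: comb ≤ -(1-ε')/s from the count bound
  have hcomb_bound : comb ≤ -(1 - ε') / s := by
    -- Each term contributes Im ≤ -1/(2h) when |x₀ - ξ| ≤ h
    have h_sum : comb ≤ -(S.card : ℝ) / (2 * h) := EpsRegularCountBound.sum_im_bound hh S hS_in
    -- From hS_count: S.card ≥ (1-ε')·2h/s
    -- So -S.card/(2h) ≤ -(1-ε')·2h/s / (2h) = -(1-ε')/s
    have h_card : -(S.card : ℝ) / (2 * h) ≤ -(1 - ε') / s := by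
      rw [neg_div, neg_div, neg_le_neg_iff]
      have h2h_pos : (0 : ℝ) < 2 * h := by positivity
      have h1 : (S.card : ℝ) / (2 * h) ≥ ((1 - ε') * 2 * h / s) / (2 * h) := by
        apply div_le_div_of_nonneg_right hS_count (by positivity)
      have h2 : ((1 - ε') * 2 * h / s) / (2 * h) = (1 - ε') / s := by
        have hs_ne : s ≠ 0 := ne_of_gt hs
        have hh_ne : (2 * h : ℝ) ≠ 0 := ne_of_gt h2h_pos
        field_simp
      linarith [h1, h2]
    linarith [h_sum, h_card]
  -- Step 4: Apply G_im_bound logic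
  -- G_im = -1/(2h) + comb + η/s ≤ -1/(2h) - (1-ε')/s + η/s = -1/(2h) - (1-ε'-η)/s
  have h_G_bound : G_im ≤ -1 / (2 * h) - (1 - ε' - η) / s := by
    have h1 : comb + η / s ≤ -(1 - ε') / s + η / s := by linarith [hcomb_bound]
    have h2 : -(1 - ε') / s + η / s = -(1 - ε' - η) / s := by field_simp; ring
    calc G_im = -1 / (2 * h) + comb + η / s := rfl
      _ = -1 / (2 * h) + (comb + η / s) := by ring
      _ ≤ -1 / (2 * h) + (-(1 - ε' - η) / s) := by linarith [h1, h2]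
      _ = -1 / (2 * h) - (1 - ε' - η) / s := by ring
  -- Step 5: (1-ε'-η)/s ≥ (5/8)/s ≥ 5/h (from 8s ≤ h)
  have h_frac : (1 - ε' - η) / s ≥ 5 / h := by
    have h1 : 1 / s ≥ 8 / h := by
      rw [ge_iff_le, div_le_div_iff₀ hh hs]
      linarith
    have h2 : (1 - ε' - η) / s ≥ (5 / 8) / s := by
      apply div_le_div_of_nonneg_right h_coeff (le_of_lt hs)
    have h3 : (5 / 8) / s = (5 / 8) * (1 / s) := by ring
    have h4 : (5 / 8) * (8 / h) = 5 / h := by ring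
    calc (1 - ε' - η) / s ≥ (5 / 8) / s := h2
      _ = (5 / 8) * (1 / s) := h3
      _ ≥ (5 / 8) * (8 / h) := by nlinarith [h1]
      _ = 5 / h := h4
  -- Step 6: G_im ≤ -1/(2h) - 5/h = -11/(2h)
  have h_G_bound2 : G_im ≤ -11 / (2 * h) := by
    have h1 : -1 / (2 * h) - 5 / h = -11 / (2 * h) := by field_simp; ring
    linarith [h_G_bound, h_frac, h1]
  -- Step 7: -G_im ≥ 11/(2h) > 4/h
  -- From h_G_bound2: G_im ≤ -11/(2h) means -G_im ≥ 11/(2h)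
  have h2h_pos : (0 : ℝ) < 2 * h := by positivity
  have h_11_over_2h_pos : 11 / (2 * h) > 0 := by positivity
  have h_4_over_h_pos : 4 / h > 0 := by positivity
  -- Show -G_im > 4/h by: -G_im ≥ 11/(2h) > 4/h
  have h1 : 11 / (2 * h) > 4 / h := by
    have : 11 * h > 4 * (2 * h) := by nlinarith
    rw [gt_iff_lt, div_lt_div_iff₀ hh h2h_pos]
    linarith
  -- From h_G_bound2: G_im ≤ -11/(2h), so -G_im ≥ 11/(2h)
  have h2 : -G_im ≥ 11 / (2 * h) := by
    have neg_ineq : -G_im ≥ -(-11 / (2 * h)) := neg_le_neg h_G_bound2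
    have : -(-11 / (2 * h)) = 11 / (2 * h) := by ring
    rw [this] at neg_ineq
    exact neg_ineq
  linarith [h1, h2]

end GBoundComplete

end
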